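import Summits.MatrixMultiplication.MatrixMultiplication.Theses.AssociativePencil

/-!
# `AssociativePencil.Assembly` (stmt-MatrixMultiplication-7196) — proved

Route `MatrixMultiplication/AssociativePencil`, assembly item `Assembly` (rank 1):

  `LagrangeNodeBound → RankBoundToOmega → TameNodeCurves → MatrixMultiplication`.

Proof (pure bookkeeping, self-contained; it follows — but does not invoke — the route file's
kernel-checked deciding theorem `Theses.AssociativePencil.closes`, whose type is literally this
implication). By `MatrixMultiplication_iff` the goal is `ω(ℂ) = 2`; `2 ≤ ω(ℂ)` is the flattening
bound `omega_two_le`, so it suffices to show `ω(ℂ) ≤ 2 + ε` for every `ε > 0`. Fix `ε > 0`;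
`TameNodeCurves` gives `C > 0` and, for every `n₀`, some `n ≥ n₀`, `n ≥ 2`, a degree-`s` polynomial
family `ν` of products on `ℂ^{n×n}` with top coefficient `ν_s = ⟨n,n,n⟩`, `s + 1 ≤ n^ε`, and
`s + 1` distinct nodes whose fibres have tensor rank `≤ C·n²`. `LagrangeNodeBound`
(divided-difference Lagrange interpolation) gives `R(⟨n,n,n⟩) = R(ν_s) ≤ Σ_i R(F(node i))
≤ (s+1)·C·n² ≤ n^ε·C·n² = C·n^{2+ε}`; this is exactly the hypothesis of `RankBoundToOmega`, which
returns `ω(ℂ) ≤ 2 + ε`. (The associativity clause of `TameNodeCurves` is not needed for the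
bookkeeping and is discarded.)

References: M. Bläser, *Fast Matrix Multiplication*, Theory of Computing Graduate Surveys 5 (2013),
Thm. 5.9; P. Bürgisser, M. Clausen, M. A. Shokrollahi, *Algebraic Complexity Theory* (1997),
Prop. (15.26).
-/

-- Single-conjunct summit: `Summit.MatrixMultiplication.MatrixMultiplication.…` repeats the name by design (D-0017).
set_option linter.dupNamespace false

namespace Summit.MatrixMultiplication.MatrixMultiplication.Theorems

open Summit.MatrixMultiplication.MatrixMultiplication.Theses.AssociativePencil
open Literature.Computability.AlgebraicComplexity

/-- The rate bookkeeping of route AssociativePencil: given `LagrangeNodeBound` and the data of one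
tame-node curve at size `n ≥ 2` (top coefficient `⟨n,n,n⟩`, `s + 1 ≤ n^ε` nodes, each node fibre of
tensor rank `≤ C·n²`, `C > 0`), one has `R(⟨n,n,n⟩) ≤ C·n^{2+ε}`:
`R(⟨n,n,n⟩) = R(ν_s) ≤ Σ_i R(F(node i)) ≤ (s+1)·C·n² ≤ n^ε·C·n²`. [folklore] -/
theorem associativePencil_tensorRank_matMul_le_of_tameNodes (hL : LagrangeNodeBound)
    {ε C : ℝ} (hC : 0 < C) {n : ℕ} (h2 : 2 ≤ n) {s : ℕ} (hs : (s : ℝ) + 1 ≤ (n : ℝ) ^ ε)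
    (ν : Fin (s + 1) → (Fin n × Fin n → Fin n × Fin n → Fin n × Fin n → ℂ))
    (hνs : ν (Fin.last s) = matMulTensor ℂ n n n)
    (node : Fin (s + 1) → ℂ) (hnode : Function.Injective node)
    (htame : ∀ i, (tensorRank (fun z x y => ∑ j : Fin (s + 1), node i ^ (j : ℕ) * ν j z x y) : ℝ)
      ≤ C * (n : ℝ) ^ 2) :
    (tensorRank (matMulTensor ℂ n n n) : ℝ) ≤ C * (n : ℝ) ^ (2 + ε) := by
  -- Lagrange interpolation at the `s + 1` nodes: `R(ν_s) ≤ ∑ i, R(F(node i))`, and `ν_s = ⟨n,n,n⟩`.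
  have hLag := hL n s ν node hnode
  rw [hνs] at hLag
  have hLagR : (tensorRank (matMulTensor ℂ n n n) : ℝ) ≤
      ∑ i : Fin (s + 1), (tensorRank (fun z x y => ∑ j : Fin (s + 1), node i ^ (j : ℕ) * ν j z x y) : ℝ) := by
    exact_mod_cast hLag
  have hn0 : (0 : ℝ) < n := by exact_mod_cast (lt_of_lt_of_le (by norm_num) h2 : 0 < n)
  have hCn : (0 : ℝ) ≤ C * (n : ℝ) ^ 2 := by positivity
  -- tame nodes: each `R(F(node i)) ≤ C n²`, and `s + 1 ≤ n^ε`.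
  calc (tensorRank (matMulTensor ℂ n n n) : ℝ)
      ≤ ∑ i : Fin (s + 1), (tensorRank (fun z x y => ∑ j : Fin (s + 1), node i ^ (j : ℕ) * ν j z x y) : ℝ) :=
        hLagR
    _ ≤ ∑ _i : Fin (s + 1), C * (n : ℝ) ^ 2 := Finset.sum_le_sum fun i _ => htame i
    _ = ((s : ℝ) + 1) * (C * (n : ℝ) ^ 2) := by
        rw [Finset.sum_const, Finset.card_univ, Fintype.card_fin, nsmul_eq_mul]
        push_cast
        ring
    _ ≤ (n : ℝ) ^ ε * (C * (n : ℝ) ^ 2) := mul_le_mul_of_nonneg_right hs hCn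
    _ = C * (n : ℝ) ^ (2 + ε) := by
        rw [Real.rpow_add hn0, Real.rpow_two]
        ring

/-- From `LagrangeNodeBound`, `RankBoundToOmega` and `TameNodeCurves`: `ω(ℂ) ≤ 2 + ε` for every
`ε > 0` (the tame-node curves at infinitely many `n` give `R(⟨n,n,n⟩) ≤ C·n^{2+ε}` infinitely often,
and one format at a time suffices). [folklore] -/
theorem associativePencil_omega_le_two_add (hL : LagrangeNodeBound) (hR : RankBoundToOmega)
    (hT : TameNodeCurves) {ε : ℝ} (hε : 0 < ε) : omega ℂ ≤ 2 + ε := by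
  obtain ⟨C, hC, hall⟩ := hT ε hε
  refine hR ε hε C hC fun n₀ => ?_
  obtain ⟨n, hn₀, h2, s, hs, ν, hνs, -, node, hnode, htame⟩ := hall n₀
  exact ⟨n, hn₀, h2,
    associativePencil_tensorRank_matMul_le_of_tameNodes hL hC h2 hs ν hνs node hnode htame⟩

/-- **Assembly of route AssociativePencil** (item stmt-MatrixMultiplication-7196):
`LagrangeNodeBound → RankBoundToOmega → TameNodeCurves → MatrixMultiplication`. Tame-node curves of
associative products through `Mat_n` (top coefficient `⟨n,n,n⟩`, `≤ n^ε` nodes of rank `≤ C·n²`),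
read through divided-difference Lagrange interpolation (`LagrangeNodeBound`), give
`R(⟨n,n,n⟩) ≤ C·n^{2+ε}` for infinitely many `n`, hence `ω(ℂ) ≤ 2 + ε` (`RankBoundToOmega`) for
every `ε > 0`, so `ω(ℂ) ≤ 2`; with `2 ≤ ω(ℂ)` (`omega_two_le`, flattening bound) this is
`ω(ℂ) = 2`, i.e. `MatrixMultiplication` (`MatrixMultiplication_iff`). The statement is literally the
type of the route's deciding theorem `Theses.AssociativePencil.closes`; the proof here is
self-contained. [cite: Blaser2013, Thm. 5.9] [cite: BurgisserClausenShokrollahi1997, Prop. (15.26)] -/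
theorem associativePencil_assembly_proof :
    Summit.MatrixMultiplication.MatrixMultiplication.Theses.AssociativePencil.Assembly := by
  unfold Summit.MatrixMultiplication.MatrixMultiplication.Theses.AssociativePencil.Assembly
  intro hL hR hT
  rw [_root_.MatrixMultiplication_iff]
  refine le_antisymm ?_ (omega_two_le ℂ)
  exact le_of_forall_pos_le_add fun ε hε => associativePencil_omega_le_two_add hL hR hT hε

end Summit.MatrixMultiplication.MatrixMultiplication.Theorems
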